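import Summits.BirchSwinnertonDyer.BirchSwinnertonDyer.Theorems.InertBadSignedBranchesPrintReadingsOfLiterature
import Summits.BirchSwinnertonDyer.Rank1Residual.Additive.CyclotomicTowerSignedSelmerEtaSummand
import Summits.BirchSwinnertonDyer.Rank1Residual.Additive.ChiEigenPrimeToPDescentGenerator
import Literature.NumberTheory.EllipticCurves.KitajimaOtsuki2018.TowerSignedSelmerNoFiniteSubmodule
import HarnessLib

/-!
# Route `InertBadSignedBranches` (rung K8), support item `SignedReadingFacts`
# (stmt-BirchSwinnertonDyer-19502; first conjunct = the `η`-component Kitajima–Otsuki fact) and the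
# aside `PrintReadingsInert` (stmt-BirchSwinnertonDyer-19226, conjunct 2, reading (R2)): the
# `η`-component Kitajima–Otsuki reading FROM THE PRINTED (whole-module) fact — the reading flag
# `KO18-eta-summand` RETIRED in the kernel
# (helper `--supports 19502`; cell bsd-cm, AUTHORED by seat bsd-cm-k8i-ty g3 (typer lane, no
# Theorems permission; WANTED 2026-08-26T07:18Z), FILED verbatim — this header apart — by seat
# bsd-cm-k7r-c4 g3; D-0074 group (G); also bsd-potss K8-Gss2 (R2±), items 19117 / 19233)

HONEST FRAMING (cell bsd-cm, `run/shared/lean/pub/bsd-cm/`): BSD is NOT proved by any of this; the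
programme assembles the rank-`≤ 1` formula from PUBLISHED theorems and TYPES the remainder; a closed
item closes a rung leaf, never the summit. THIS FILE books nothing and moves no label; TWO transparent
definitions (the `rfl` transports of the WHOLE dual datum, both ways) and theorems; NO new fact, no
`sorry`.

WHAT. The Literature now carries Kitajima–Otsuki's Main Thm. 1.3 for `F = ℚ` in its PRINTED shape —
on the WHOLE dual `X^ε(E/ℚ(μ_{p^∞}))` (`KitajimaOtsuki2018.mainThm13_towerSignedSelmerDual_noFiniteSubmodule`,
on `Kobayashi2003.TowerSignedSelmerDualData`) — and Kobayashi's Thm. 2.2 for the whole dual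
(`Kobayashi2003.thm22_towerSignedSelmerDual_finite_torsion`). Cell `bsd-potss` (seat k8q-c5, p418525 /
p418977) proved in the kernel that «no non-zero finite `Λ`-submodule» DESCENDS from the whole dual to
every `η`-component (`Additive.EtaSignedSelmerDualData.forall_finite_eq_bot_of_tower`: an injective
`Λ`-linear `X^ε(E/K_∞)^η ↪ X^ε(E/K_∞)` dual to the `η`-average, onto because `p ∤ ♯Δ = p − 1`), on the
Summits twin `Additive.TowerSignedSelmerDualData` of the Literature datum (FIELD-IDENTICAL; §1 transports
by `rfl` on every field, exactly as `PrintReadingsOfLiterature.toLiterature/ofLiterature` do for the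
`η`-data). Composing: the `η`-component statement the consumers read —
`KitajimaOtsuki2018.mainThm13_etaSignedSelmerDual_noFiniteSubmodule` (flag `KO18-eta-summand`), x1b's
`hKO`, k8i-c41's `…oddHead_noFiniteSubmodule_of_kitajimaOtsuki13` — is a THEOREM from the two
whole-module facts (§2), hence so is (R2) `Additive.OddBranchStrictMinusNoFiniteSubmoduleAt W p` for
every `(W, p)` (§3), and Kobayashi's Thm. 2.2 at `η` follows from the whole one the same way (§2).
After this file the only named facts behind (R2) are the two PRINTED-shape ones; the `η`-summand step is
kernel-certified.

References: [KitajimaOtsuki2018] Main Thm. 1.3 (= Thm. 4.8), Remark 1.4 (5), §4 (arXiv:1607.03612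
pp. 3, 4, 18); [Kobayashi2003] Def. 2.1, Thm. 2.2 (p. 5), §3 p. 5, §4 p. 8 (`M^η = ε_η M`).
-/

-- `Summit.BirchSwinnertonDyer.BirchSwinnertonDyer.…` is the lane's mandated namespace (sub = summit).
set_option linter.dupNamespace false

noncomputable section

open scoped Classical

open WeierstrassCurve Field Literature.NumberTheory.EllipticCurves
  Literature.NumberTheory.GaloisRepresentations ZpExtension
  Summit.BirchSwinnertonDyer.Rank1Residual Summit.BirchSwinnertonDyer.Rank1Residual.Additive

namespace Summit.BirchSwinnertonDyer.BirchSwinnertonDyer.Theorems.TowerReadingsOfLiterature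

/-! ## §1 The bridge for the WHOLE dual datum: Literature copy = Summits original (`rfl`) -/

section Bridge

universe u

variable {K : Type u} [Field K] [NumberField K] {p : ℕ} [Fact p.Prime]
  (W : WeierstrassCurve K) (κ : ZpExtension K p) (K₀ : Type u) [Field K₀] [NumberField K₀]
  [Algebra K K₀] [(galRange (K := K) K₀).Normal] (E : Type u) [Field E] [Algebra K E]
  (γ : absoluteGaloisGroup K) (ε : ℤˣ)

/-- **The transport**: a Summits-side whole dual datum of `Sel^ε(E/K_∞)` (bsd-potss's
`Additive.TowerSignedSelmerDualData`) IS a Literature-side one (`Kobayashi2003.TowerSignedSelmerDualData`),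
with the same module — every field carried verbatim (`Kobayashi2003.towerSignedSelmerInfty =
Additive.towerSignedSelmerInfty` is `rfl`). [cite: Kobayashi2003, Def. 2.1 (p. 5)] -/
def toLiterature (D : Additive.TowerSignedSelmerDualData W κ K₀ E γ ε) :
    Literature.NumberTheory.EllipticCurves.Kobayashi2003.TowerSignedSelmerDualData W κ K₀ E γ ε :=
  ⟨D.X, D.conj_mem, D.toDual, D.bijective, D.toDual_T_smul, D.toDual_C_smul⟩

/-- Same module and same characteristic ideal. [cite: Kobayashi2003, Thm. 2.2 (p. 5) (the object)] -/
theorem toLiterature_charIdeal (D : Additive.TowerSignedSelmerDualData W κ K₀ E γ ε) :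
    (toLiterature W κ K₀ E γ ε D).X = D.X ∧
      (toLiterature W κ K₀ E γ ε D).charIdeal = D.charIdeal := ⟨rfl, rfl⟩

/-- **The transport back**: a Literature-side whole datum IS a Summits-side one (same fields).
[cite: Kobayashi2003, Def. 2.1 (p. 5)] -/
def ofLiterature
    (D' : Literature.NumberTheory.EllipticCurves.Kobayashi2003.TowerSignedSelmerDualData W κ K₀ E γ ε) :
    Additive.TowerSignedSelmerDualData W κ K₀ E γ ε :=
  ⟨D'.X, D'.conj_mem, D'.toDual, D'.bijective, D'.toDual_T_smul, D'.toDual_C_smul⟩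

/-- Same module and same characteristic ideal. [cite: Kobayashi2003, Thm. 2.2 (p. 5) (the object)] -/
theorem ofLiterature_charIdeal
    (D' : Literature.NumberTheory.EllipticCurves.Kobayashi2003.TowerSignedSelmerDualData W κ K₀ E γ ε) :
    (ofLiterature W κ K₀ E γ ε D').X = D'.X ∧
      (ofLiterature W κ K₀ E γ ε D').charIdeal = D'.charIdeal := ⟨rfl, rfl⟩

end Bridge

/-! ## §2 The `η`-component facts as THEOREMS from the whole-module (printed-shape) facts -/

section Eta

/-- **Kobayashi's Thm. 2.2 at `η` from Thm. 2.2 for the whole `X^ε(E/K_∞)`**: the named fact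
`Kobayashi2003.thm22_etaSignedSelmerDual_finite_torsion` (finite generation + torsion of every
`η`-datum) follows from the whole-module fact through bsd-potss's injective `Λ`-linear
`X^ε(E/K_∞)^η ↪ X^ε(E/K_∞)` (`Additive.EtaSignedSelmerDualData.finite_isTorsion_of_tower`), the whole
datum being bsd-potss's construction `Additive.towerSignedSelmerDualData` (κ onto on `Gal(ℚ̄/ℚ(μ_p))`:
`kappa_surjOn_galRange_cyclotomic`; `p ∤ [ℚ(μ_p) : ℚ]`: `coprime_index_galRange_cyclotomic`).
[cite: Kobayashi2003, Thm. 2.2 (p. 5) and §4 p. 8 l. 16] -/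
theorem thm22_eta_of_tower
    (h22 : Literature.NumberTheory.EllipticCurves.Kobayashi2003.thm22_towerSignedSelmerDual_finite_torsion) :
    Literature.NumberTheory.EllipticCurves.Kobayashi2003.thm22_etaSignedSelmerDual_finite_torsion := by
  intro p _ K₀ _ _ _ _ η hηK V _ _ hp hgood hap κ γ hκ hγ hγ₀ ε Dη
  have hK₀ := kappa_surjOn_galRange_cyclotomic κ K₀
  have hcop := coprime_index_galRange_cyclotomic p K₀
  let D : Additive.TowerSignedSelmerDualData V κ K₀ ℚ_[p] γ ε :=
    towerSignedSelmerDualData V κ K₀ ℚ_[p] ε hK₀ hγ hγ₀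
  have hD := h22 p K₀ V hp hgood hap κ γ hκ hγ hγ₀ ε (toLiterature V κ K₀ ℚ_[p] γ ε D)
  exact Additive.EtaSignedSelmerDualData.finite_isTorsion_of_tower V κ K₀ ℚ_[p] η ε hK₀ hγ hγ₀ hηK
    hcop D (PrintReadingsOfLiterature.ofLiterature V κ K₀ ℚ_[p] η γ ε Dη) hD

/-- **Kitajima–Otsuki's Main Thm. 1.3 at `η` (the reading `KO18-eta-summand`) from the PRINTED whole-module
fact and Kobayashi's whole-module Thm. 2.2**: the named fact
`KitajimaOtsuki2018.mainThm13_etaSignedSelmerDual_noFiniteSubmodule` is a THEOREM conditional on the two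
printed-shape facts — the whole dual `X^ε(E/K_∞)` (bsd-potss's construction) is finitely generated and
torsion by Thm. 2.2, so has no non-zero finite `Λ`-submodule by Main Thm. 1.3, and this DESCENDS to every
`η`-component by `Additive.EtaSignedSelmerDualData.forall_finite_eq_bot_of_tower` (no hypothesis on the
`η`-datum is used). [cite: KitajimaOtsuki2018, Main Thm. 1.3 (= Thm. 4.8) and Remark 1.4 (5) (arXiv:1607.03612 pp. 3–4)]
[cite: Kobayashi2003, Thm. 2.2 (p. 5), §4 p. 8 (M^η = ε_η M)] -/
theorem mainThm13_eta_of_tower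
    (h13 : Literature.NumberTheory.EllipticCurves.KitajimaOtsuki2018.mainThm13_towerSignedSelmerDual_noFiniteSubmodule)
    (h22 : Literature.NumberTheory.EllipticCurves.Kobayashi2003.thm22_towerSignedSelmerDual_finite_torsion) :
    Literature.NumberTheory.EllipticCurves.KitajimaOtsuki2018.mainThm13_etaSignedSelmerDual_noFiniteSubmodule := by
  intro p _ K₀ _ _ _ _ η hηK V _ _ hp hgood hap κ γ hκ hγ hγ₀ ε Dη _ _ M hM
  have hK₀ := kappa_surjOn_galRange_cyclotomic κ K₀
  have hcop := coprime_index_galRange_cyclotomic p K₀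
  let D : Additive.TowerSignedSelmerDualData V κ K₀ ℚ_[p] γ ε :=
    towerSignedSelmerDualData V κ K₀ ℚ_[p] ε hK₀ hγ hγ₀
  obtain ⟨hfg, htors⟩ := h22 p K₀ V hp hgood hap κ γ hκ hγ hγ₀ ε (toLiterature V κ K₀ ℚ_[p] γ ε D)
  have hD : ∀ N : Submodule (IwasawaAlgebra p) D.X, Finite N → N = ⊥ :=
    h13 p K₀ V hp hgood hap κ γ hκ hγ hγ₀ ε (toLiterature V κ K₀ ℚ_[p] γ ε D) hfg htors
  exact Additive.EtaSignedSelmerDualData.forall_finite_eq_bot_of_tower V κ K₀ ℚ_[p] η ε hK₀ hγ hγ₀ hηK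
    hcop D (PrintReadingsOfLiterature.ofLiterature V κ K₀ ℚ_[p] η γ ε Dη) hD M hM

end Eta

/-! ## §3 (R2) for EVERY `(W, p)`, modulo the two PRINTED-shape facts only -/

section Readings

variable (W : WeierstrassCurve ℚ) [W.IsElliptic] [W.IsGloballyMinimal] (p : ℕ) [Fact p.Prime]

/-- **(R2) `Additive.OddBranchStrictMinusNoFiniteSubmoduleAt W p` for every `(W, p)`, modulo
Kitajima–Otsuki's Main Thm. 1.3 (`F = ℚ`, whole dual) and Kobayashi's Thm. 2.2 (whole dual) — BOTH IN
THEIR PRINTED SHAPE**: `PrintReadingsOfLiterature.oddBranchStrictMinusNoFiniteSubmoduleAt_of_kitajimaOtsuki`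
(x1b's P5-5b dictionary) fed with `mainThm13_eta_of_tower`. No `η`-reading flag remains on (R2).
[cite: KitajimaOtsuki2018, Main Thm. 1.3 (= Thm. 4.8) with Def. 2.1] [cite: Kobayashi2003, Thm. 2.2 (p. 5)] -/
theorem oddBranchStrictMinusNoFiniteSubmoduleAt_of_tower
    (h13 : Literature.NumberTheory.EllipticCurves.KitajimaOtsuki2018.mainThm13_towerSignedSelmerDual_noFiniteSubmodule)
    (h22 : Literature.NumberTheory.EllipticCurves.Kobayashi2003.thm22_towerSignedSelmerDual_finite_torsion) :
    OddBranchStrictMinusNoFiniteSubmoduleAt W p :=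
  PrintReadingsOfLiterature.oddBranchStrictMinusNoFiniteSubmoduleAt_of_kitajimaOtsuki W p
    (mainThm13_eta_of_tower h13 h22)

end Readings

end Summit.BirchSwinnertonDyer.BirchSwinnertonDyer.Theorems.TowerReadingsOfLiterature

end
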